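import Mathlib
import HarnessLib

/-!
# Maximum likelihood estimation as convex optimisation
(Boyd–Vandenberghe, *Convex Optimization*, §7.1.1)

Source: S. Boyd, L. Vandenberghe, *Convex Optimization*, Cambridge University Press (2004)
[cite: BoydVandenberghe2004] — open copy read, §7.1.1 "Maximum likelihood estimation"
(pp. 351–355): the ML problem (7.1); *linear measurements with IID noise* `yᵢ = aᵢᵀx + vᵢ`,
likelihood `∏ p(yᵢ − aᵢᵀx)`, log-likelihood `l(x) = ∑ log p(yᵢ − aᵢᵀx)` (7.2), "a penalty
approximation problem with penalty `−log p`"; Example 7.1 (Gaussian noise ⇒ least squares,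
Laplacian noise ⇒ `ℓ₁`-norm approximation, uniform noise ⇒ any `x` with `‖Ax − y‖∞ ≤ a`);
the converse *ML interpretation of penalty function approximation* (`p = e^{−φ}/∫e^{−φ}`);
*counting problems with Poisson distribution* (log-likelihood `∑ (yᵢ log μᵢ − μᵢ − log yᵢ!)`,
`μ` affine in the parameters, a concave maximisation); and *logistic regression*
(`l = ∑_{yᵢ=1} zᵢ − ∑ᵢ log(1 + e^{zᵢ})`, concave).

## Setting

The parameter lives in a real vector space `E`; the `m` linear measurement functionals are
packaged as a linear map `A : E →ₗ[ℝ] (ι → ℝ)` (`(A x) i = aᵢᵀx`), so the residuals are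
`yᵢ − A x i`.  Densities are real functions; the likelihood is the finite product, the
log-likelihood the finite sum of logs (for positive densities these determine the same
maximisers, `isMaxOn_lik_iff`).  The uniform-noise case is stated for the likelihood itself
(its log is not meaningful where the density vanishes).
-/

namespace Literature.Analysis.Convex.MaximumLikelihoodEstimation

open Set Real Finset
open scoped BigOperators

noncomputable section

variable {E : Type*} [AddCommGroup E] [Module ℝ E] {ι : Type*} [Fintype ι]

/-! ## Likelihood and log-likelihood for linear measurements with IID noise (7.2) -/

/-- The likelihood `pₓ(y) = ∏ p(yᵢ − aᵢᵀx)`. [cite: BoydVandenberghe2004, §7.1.1] -/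
def lik (p : ℝ → ℝ) (A : E →ₗ[ℝ] (ι → ℝ)) (y : ι → ℝ) (x : E) : ℝ := ∏ i, p (y i - A x i)

/-- The log-likelihood `l(x) = ∑ log p(yᵢ − aᵢᵀx)` (7.2).
[cite: BoydVandenberghe2004, §7.1.1 (7.2)] -/
def logLik (p : ℝ → ℝ) (A : E →ₗ[ℝ] (ι → ℝ)) (y : ι → ℝ) (x : E) : ℝ :=
  ∑ i, Real.log (p (y i - A x i))

/-- [cite: BoydVandenberghe2004, §7.1.1 (7.2)] -/
theorem log_lik {p : ℝ → ℝ} (hp : ∀ z, 0 < p z) (A : E →ₗ[ℝ] (ι → ℝ)) (y : ι → ℝ) (x : E) :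
    Real.log (lik p A y x) = logLik p A y x :=
  Real.log_prod fun i _ => (hp (y i - A x i)).ne'

/-- [cite: BoydVandenberghe2004, §7.1.1] -/
theorem lik_pos {p : ℝ → ℝ} (hp : ∀ z, 0 < p z) (A : E →ₗ[ℝ] (ι → ℝ)) (y : ι → ℝ) (x : E) :
    0 < lik p A y x :=
  Finset.prod_pos fun _ _ => hp _

/-- For a positive density, maximising the likelihood and the log-likelihood are the same
problem. [cite: BoydVandenberghe2004, §7.1.1] -/
theorem isMaxOn_lik_iff {p : ℝ → ℝ} (hp : ∀ z, 0 < p z) (A : E →ₗ[ℝ] (ι → ℝ)) (y : ι → ℝ)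
    (s : Set E) (x : E) : IsMaxOn (lik p A y) s x ↔ IsMaxOn (logLik p A y) s x := by
  simp only [isMaxOn_iff, ← log_lik hp]
  exact forall₂_congr fun x' _ => (Real.log_le_log_iff (lik_pos hp A y x') (lik_pos hp A y x)).symm

/-- A maximiser of `a − c·f` (`c > 0`) is a minimiser of `f`.
[cite: BoydVandenberghe2004, §7.1.1] -/
theorem isMaxOn_const_sub_mul_iff {α : Type*} {f : α → ℝ} {a c : ℝ} (hc : 0 < c) (s : Set α)
    (x : α) : IsMaxOn (fun z => a - c * f z) s x ↔ IsMinOn f s x := by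
  simp only [isMaxOn_iff, isMinOn_iff, sub_le_sub_iff_left]
  exact forall₂_congr fun z _ =>
    ⟨fun h => le_of_mul_le_mul_left h hc, fun h => mul_le_mul_of_nonneg_left h hc.le⟩

/-- (7.2) is a penalty approximation problem with penalty `φ = −log p`: the ML estimates are
the minimisers of `∑ −log p(yᵢ − aᵢᵀx)`. [cite: BoydVandenberghe2004, §7.1.1 (7.2)] -/
theorem isMaxOn_logLik_iff_isMinOn_penalty (p : ℝ → ℝ) (A : E →ₗ[ℝ] (ι → ℝ)) (y : ι → ℝ)
    (s : Set E) (x : E) :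
    IsMaxOn (logLik p A y) s x ↔ IsMinOn (fun x => ∑ i, -Real.log (p (y i - A x i))) s x := by
  simp only [isMaxOn_iff, isMinOn_iff, logLik, Finset.sum_neg_distrib, neg_le_neg_iff]

/-! ## Concavity: the ML problem is convex when `p` is log-concave -/

/-- A concave function of an affine function `x ↦ c − ℓ x` is concave.
[cite: BoydVandenberghe2004, §7.1.1] -/
theorem concaveOn_comp_sub_linear {f : ℝ → ℝ} (hf : ConcaveOn ℝ univ f) (ℓ : E →ₗ[ℝ] ℝ) (c : ℝ) :
    ConcaveOn ℝ univ (fun x => f (c - ℓ x)) := by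
  refine ⟨convex_univ, fun x _ z _ a b ha hb hab => ?_⟩
  have : c - ℓ (a • x + b • z) = a • (c - ℓ x) + b • (c - ℓ z) := by
    simp only [map_add, map_smul, smul_eq_mul]; linear_combination (-c) * hab
  show a • f (c - ℓ x) + b • f (c - ℓ z) ≤ f (c - ℓ (a • x + b • z))
  rw [this]
  exact hf.2 (mem_univ _) (mem_univ _) ha hb hab

/-- A convex function of an affine function `x ↦ c − ℓ x` is convex.
[cite: BoydVandenberghe2004, §7.1.1] -/
theorem convexOn_comp_sub_linear {f : ℝ → ℝ} (hf : ConvexOn ℝ univ f) (ℓ : E →ₗ[ℝ] ℝ) (c : ℝ) :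
    ConvexOn ℝ univ (fun x => f (c - ℓ x)) := by
  refine ⟨convex_univ, fun x _ z _ a b ha hb hab => ?_⟩
  have : c - ℓ (a • x + b • z) = a • (c - ℓ x) + b • (c - ℓ z) := by
    simp only [map_add, map_smul, smul_eq_mul]; linear_combination (-c) * hab
  show f (c - ℓ (a • x + b • z)) ≤ a • f (c - ℓ x) + b • f (c - ℓ z)
  rw [this]
  exact hf.2 (mem_univ _) (mem_univ _) ha hb hab

/-- A finite sum of concave functions is concave. [cite: BoydVandenberghe2004, §7.1.1] -/
theorem concaveOn_univ_sum {κ : Type*} (t : Finset κ) {f : κ → E → ℝ}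
    (h : ∀ k ∈ t, ConcaveOn ℝ univ (f k)) : ConcaveOn ℝ univ (fun x => ∑ k ∈ t, f k x) := by
  refine ⟨convex_univ, fun x _ z _ a b ha hb hab => ?_⟩
  simp only [smul_eq_mul, Finset.mul_sum, ← Finset.sum_add_distrib]
  exact Finset.sum_le_sum fun k hk => by
    simpa [smul_eq_mul] using (h k hk).2 (mem_univ x) (mem_univ z) ha hb hab

/-- A finite sum of convex functions is convex. [cite: BoydVandenberghe2004, §7.1.1] -/
theorem convexOn_univ_sum {κ : Type*} (t : Finset κ) {f : κ → E → ℝ}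
    (h : ∀ k ∈ t, ConvexOn ℝ univ (f k)) : ConvexOn ℝ univ (fun x => ∑ k ∈ t, f k x) := by
  refine ⟨convex_univ, fun x _ z _ a b ha hb hab => ?_⟩
  simp only [smul_eq_mul, Finset.mul_sum, ← Finset.sum_add_distrib]
  exact Finset.sum_le_sum fun k hk => by
    simpa [smul_eq_mul] using (h k hk).2 (mem_univ x) (mem_univ z) ha hb hab

/-- **If the density `p` is log-concave, the ML problem (7.2) is a convex problem**: the
log-likelihood is concave in `x`. [cite: BoydVandenberghe2004, §7.1.1 (7.2)] -/
theorem concaveOn_logLik {p : ℝ → ℝ} (hlog : ConcaveOn ℝ univ (fun z => Real.log (p z)))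
    (A : E →ₗ[ℝ] (ι → ℝ)) (y : ι → ℝ) : ConcaveOn ℝ univ (logLik p A y) := by
  unfold logLik
  exact concaveOn_univ_sum _ fun i _ =>
    concaveOn_comp_sub_linear hlog ((LinearMap.proj i).comp A) (y i)

/-- Dually, the penalty approximation problem with a convex penalty has a convex objective.
[cite: BoydVandenberghe2004, §7.1.1] -/
theorem convexOn_sum_penalty {φ : ℝ → ℝ} (hφ : ConvexOn ℝ univ φ) (A : E →ₗ[ℝ] (ι → ℝ))
    (b : ι → ℝ) : ConvexOn ℝ univ (fun x => ∑ i, φ (b i - A x i)) :=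
  convexOn_univ_sum _ fun i _ => convexOn_comp_sub_linear hφ ((LinearMap.proj i).comp A) (b i)

/-! ## Example 7.1: Gaussian, Laplacian and uniform noise -/

/-- **Gaussian noise** `𝒩(0, v)`: `l(x) = −(m/2) log(2πv) − (1/2v)‖Ax − y‖₂²`.
[cite: BoydVandenberghe2004, §7.1.1 Example 7.1] -/
theorem logLik_gaussian {v : NNReal} (hv : v ≠ 0) (A : E →ₗ[ℝ] (ι → ℝ)) (y : ι → ℝ) (x : E) :
    logLik (ProbabilityTheory.gaussianPDFReal 0 v) A y x =
      -(Fintype.card ι / 2 : ℝ) * Real.log (2 * π * v) -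
        (2 * (v : ℝ))⁻¹ * ∑ i, (A x i - y i) ^ 2 := by
  have hv' : (0 : ℝ) < v := NNReal.coe_pos.mpr (pos_iff_ne_zero.mpr hv)
  have h2 : (0 : ℝ) < 2 * π * v := by positivity
  simp only [logLik, ProbabilityTheory.gaussianPDFReal, sub_zero]
  have : ∀ i, Real.log ((√(2 * π * ↑v))⁻¹ * rexp (-(y i - A x i) ^ 2 / (2 * ↑v))) =
      -(1 / 2) * Real.log (2 * π * v) - (2 * (v : ℝ))⁻¹ * (A x i - y i) ^ 2 := by
    intro i
    rw [Real.log_mul (by positivity) (Real.exp_pos _).ne', Real.log_exp, Real.log_inv,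
      Real.log_sqrt h2.le]
    ring
  simp only [this, Finset.sum_sub_distrib, Finset.sum_const, Finset.card_univ, nsmul_eq_mul,
    ← Finset.mul_sum]
  ring

/-- **Gaussian noise ⇒ least squares**: `x` is an ML estimate iff it minimises `‖Ax − y‖₂²`.
[cite: BoydVandenberghe2004, §7.1.1 Example 7.1] -/
theorem isMaxOn_logLik_gaussian_iff {v : NNReal} (hv : v ≠ 0) (A : E →ₗ[ℝ] (ι → ℝ))
    (y : ι → ℝ) (s : Set E) (x : E) :
    IsMaxOn (logLik (ProbabilityTheory.gaussianPDFReal 0 v) A y) s x ↔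
      IsMinOn (fun x => ∑ i, (A x i - y i) ^ 2) s x := by
  have hv' : (0 : ℝ) < v := NNReal.coe_pos.mpr (pos_iff_ne_zero.mpr hv)
  rw [show logLik (ProbabilityTheory.gaussianPDFReal 0 v) A y = _ from
    funext (logLik_gaussian hv A y)]
  exact isMaxOn_const_sub_mul_iff (by positivity) s x

/-- The Laplacian density `p(z) = (1/2a) e^{−|z|/a}`.
[cite: BoydVandenberghe2004, §7.1.1 Example 7.1] -/
def laplaceNoisePDF (a z : ℝ) : ℝ := (2 * a)⁻¹ * Real.exp (-|z| / a)

/-- [cite: BoydVandenberghe2004, §7.1.1 Example 7.1] -/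
theorem laplaceNoisePDF_pos {a : ℝ} (ha : 0 < a) (z : ℝ) : 0 < laplaceNoisePDF a z := by
  unfold laplaceNoisePDF; positivity

/-- **Laplacian noise**: `l(x) = −m log(2a) − (1/a)‖Ax − y‖₁`.
[cite: BoydVandenberghe2004, §7.1.1 Example 7.1] -/
theorem logLik_laplace {a : ℝ} (ha : 0 < a) (A : E →ₗ[ℝ] (ι → ℝ)) (y : ι → ℝ) (x : E) :
    logLik (laplaceNoisePDF a) A y x =
      -(Fintype.card ι : ℝ) * Real.log (2 * a) - a⁻¹ * ∑ i, |A x i - y i| := by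
  simp only [logLik, laplaceNoisePDF]
  have : ∀ i, Real.log ((2 * a)⁻¹ * rexp (-|y i - A x i| / a)) =
      -Real.log (2 * a) - a⁻¹ * |A x i - y i| := by
    intro i
    rw [Real.log_mul (by positivity) (Real.exp_pos _).ne', Real.log_exp, Real.log_inv,
      abs_sub_comm]
    ring
  simp only [this, Finset.sum_sub_distrib, Finset.sum_const, Finset.card_univ, nsmul_eq_mul,
    ← Finset.mul_sum]
  ring

/-- **Laplacian noise ⇒ `ℓ₁`-norm approximation**: `x` is an ML estimate iff it minimises
`‖Ax − y‖₁`. [cite: BoydVandenberghe2004, §7.1.1 Example 7.1] -/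
theorem isMaxOn_logLik_laplace_iff {a : ℝ} (ha : 0 < a) (A : E →ₗ[ℝ] (ι → ℝ)) (y : ι → ℝ)
    (s : Set E) (x : E) :
    IsMaxOn (logLik (laplaceNoisePDF a) A y) s x ↔ IsMinOn (fun x => ∑ i, |A x i - y i|) s x := by
  rw [show logLik (laplaceNoisePDF a) A y = _ from funext (logLik_laplace ha A y)]
  exact isMaxOn_const_sub_mul_iff (by positivity) s x

/-- The uniform density on `[−a, a]`. [cite: BoydVandenberghe2004, §7.1.1 Example 7.1] -/
def uniformNoisePDF (a z : ℝ) : ℝ := if |z| ≤ a then (2 * a)⁻¹ else 0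

/-- **Uniform noise**: the likelihood is `(2a)^{−m}` if `‖Ax − y‖∞ ≤ a` and `0` otherwise.
[cite: BoydVandenberghe2004, §7.1.1 Example 7.1] -/
theorem lik_uniform (a : ℝ) (A : E →ₗ[ℝ] (ι → ℝ)) (y : ι → ℝ) (x : E) :
    lik (uniformNoisePDF a) A y x =
      if ∀ i, |A x i - y i| ≤ a then ((2 * a)⁻¹) ^ Fintype.card ι else 0 := by
  unfold lik uniformNoisePDF
  split_ifs with h
  · rw [Finset.prod_congr rfl fun i _ => if_pos (by rw [abs_sub_comm]; exact h i),
      Finset.prod_const, Finset.card_univ]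
  · push Not at h
    obtain ⟨i, hi⟩ := h
    exact Finset.prod_eq_zero (Finset.mem_univ i)
      (if_neg (by rw [abs_sub_comm]; exact not_le.mpr hi))

/-- Any `x` with `‖Ax − y‖∞ ≤ a` is an ML estimate under uniform noise.
[cite: BoydVandenberghe2004, §7.1.1 Example 7.1] -/
theorem isMaxOn_lik_uniform {a : ℝ} (ha : 0 < a) (A : E →ₗ[ℝ] (ι → ℝ)) (y : ι → ℝ) {x : E}
    (hx : ∀ i, |A x i - y i| ≤ a) : IsMaxOn (lik (uniformNoisePDF a) A y) univ x := by
  intro x' _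
  simp only [mem_setOf_eq, lik_uniform, if_pos hx]
  split_ifs
  · exact le_rfl
  · positivity

/-- **Uniform noise ⇒ `ℓ∞` feasibility**: when some parameter is consistent with the data,
the ML estimates are exactly the `x` with `‖Ax − y‖∞ ≤ a`.
[cite: BoydVandenberghe2004, §7.1.1 Example 7.1] -/
theorem isMaxOn_lik_uniform_iff {a : ℝ} (ha : 0 < a) (A : E →ₗ[ℝ] (ι → ℝ)) (y : ι → ℝ)
    (hfeas : ∃ x', ∀ i, |A x' i - y i| ≤ a) (x : E) :
    IsMaxOn (lik (uniformNoisePDF a) A y) univ x ↔ ∀ i, |A x i - y i| ≤ a := by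
  refine ⟨fun h => ?_, isMaxOn_lik_uniform ha A y⟩
  obtain ⟨x', hx'⟩ := hfeas
  by_contra hx
  have := h (mem_univ x')
  simp only [mem_setOf_eq, lik_uniform, if_pos hx', if_neg hx] at this
  exact absurd this (not_le.mpr (by positivity))

/-! ## ML interpretation of penalty function approximation -/

/-- The noise density `p = e^{−φ}/Z` attached to a penalty function `φ`
(`Z = ∫ e^{−φ(u)} du`). [cite: BoydVandenberghe2004, §7.1.1] -/
def penaltyPDF (φ : ℝ → ℝ) (Z : ℝ) (z : ℝ) : ℝ := Real.exp (-φ z) / Z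

/-- [cite: BoydVandenberghe2004, §7.1.1] -/
theorem penaltyPDF_pos (φ : ℝ → ℝ) {Z : ℝ} (hZ : 0 < Z) (z : ℝ) : 0 < penaltyPDF φ Z z := by
  unfold penaltyPDF; positivity

/-- With `Z = ∫ e^{−φ}` (finite), `p = e^{−φ}/Z` is a probability density.
[cite: BoydVandenberghe2004, §7.1.1] -/
theorem integral_penaltyPDF {φ : ℝ → ℝ}
    (hφ : MeasureTheory.Integrable (fun z => Real.exp (-φ z))) :
    ∫ z, penaltyPDF φ (∫ u, Real.exp (-φ u)) z = 1 := by
  have hZ : 0 < ∫ u, Real.exp (-φ u) := MeasureTheory.integral_exp_pos hφ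
  simp only [penaltyPDF, MeasureTheory.integral_div, div_self hZ.ne']

/-- The log-likelihood for the density `e^{−φ}/Z`: `l(x) = −∑ φ(bᵢ − aᵢᵀx) − m log Z`.
[cite: BoydVandenberghe2004, §7.1.1] -/
theorem logLik_penaltyPDF (φ : ℝ → ℝ) {Z : ℝ} (hZ : 0 < Z) (A : E →ₗ[ℝ] (ι → ℝ)) (b : ι → ℝ)
    (x : E) : logLik (penaltyPDF φ Z) A b x =
      -(Fintype.card ι : ℝ) * Real.log Z - ∑ i, φ (b i - A x i) := by
  simp only [logLik, penaltyPDF, Real.log_div (Real.exp_pos _).ne' hZ.ne', Real.log_exp,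
    Finset.sum_sub_distrib, Finset.sum_neg_distrib, Finset.sum_const, Finset.card_univ,
    nsmul_eq_mul]
  ring

/-- **Every penalty approximation problem is an ML estimation problem**: the minimisers of
`∑ φ(bᵢ − aᵢᵀx)` are exactly the ML estimates for the noise density `e^{−φ}/Z`.
[cite: BoydVandenberghe2004, §7.1.1] -/
theorem isMaxOn_logLik_penaltyPDF_iff (φ : ℝ → ℝ) {Z : ℝ} (hZ : 0 < Z) (A : E →ₗ[ℝ] (ι → ℝ))
    (b : ι → ℝ) (s : Set E) (x : E) :
    IsMaxOn (logLik (penaltyPDF φ Z) A b) s x ↔ IsMinOn (fun x => ∑ i, φ (b i - A x i)) s x := by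
  rw [show logLik (penaltyPDF φ Z) A b = _ from funext (logLik_penaltyPDF φ hZ A b)]
  simpa using isMaxOn_const_sub_mul_iff (f := fun x => ∑ i, φ (b i - A x i))
    (a := -(Fintype.card ι : ℝ) * Real.log Z) one_pos s x

/-! ## Counting problems with Poisson distribution -/

section Poisson

variable {Θ : Type*} [AddCommGroup Θ] [Module ℝ Θ]

/-- The Poisson log-likelihood `l(θ) = ∑ (yᵢ log μᵢ(θ) − μᵢ(θ) − log yᵢ!)` for counts `yᵢ` with
means `μᵢ(θ) = (M θ) i` linear in the model parameters (`θ = (a, b)`, `μᵢ = aᵀuᵢ + b`).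
[cite: BoydVandenberghe2004, §7.1.1] -/
def poissonLogLik (M : Θ →ₗ[ℝ] (ι → ℝ)) (y : ι → ℕ) (θ : Θ) : ℝ :=
  ∑ i, ((y i : ℝ) * Real.log (M θ i) - M θ i - Real.log (Nat.factorial (y i)))

/-- It is the logarithm of the likelihood `∏ e^{−μᵢ} μᵢ^{yᵢ}/yᵢ!` (where `μ ≻ 0`).
[cite: BoydVandenberghe2004, §7.1.1] -/
theorem log_poisson_likelihood (M : Θ →ₗ[ℝ] (ι → ℝ)) (y : ι → ℕ) {θ : Θ} (hθ : ∀ i, 0 < M θ i) :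
    Real.log (∏ i, Real.exp (-M θ i) * M θ i ^ y i / Nat.factorial (y i)) =
      poissonLogLik M y θ := by
  unfold poissonLogLik
  rw [Real.log_prod]
  · refine Finset.sum_congr rfl fun i _ => ?_
    rw [Real.log_div (by have := hθ i; positivity) (by positivity),
      Real.log_mul (Real.exp_pos _).ne' (by have := hθ i; positivity), Real.log_exp,
      Real.log_pow]
    ring
  · intro i _; have := hθ i; positivity

omit [Fintype ι] in
/-- The domain `{θ | μ(θ) ≻ 0}` is convex. [cite: BoydVandenberghe2004, §7.1.1] -/
theorem convex_poissonDom (M : Θ →ₗ[ℝ] (ι → ℝ)) : Convex ℝ {θ : Θ | ∀ i, 0 < M θ i} := by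
  intro θ hθ θ' hθ' a b ha hb hab
  simp only [mem_setOf_eq, map_add, map_smul, Pi.add_apply, Pi.smul_apply, smul_eq_mul] at *
  intro i
  rcases ha.eq_or_lt with rfl | ha'
  · rw [zero_add] at hab; subst hab; simpa using hθ' i
  · nlinarith [hθ i, hθ' i]

/-- **The Poisson ML problem is a convex problem**: `l` is concave on `{θ | μ(θ) ≻ 0}`.
[cite: BoydVandenberghe2004, §7.1.1] -/
theorem concaveOn_poissonLogLik (M : Θ →ₗ[ℝ] (ι → ℝ)) (y : ι → ℕ) :
    ConcaveOn ℝ {θ : Θ | ∀ i, 0 < M θ i} (poissonLogLik M y) := by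
  refine ⟨convex_poissonDom M, fun θ hθ θ' hθ' a b ha hb hab => ?_⟩
  simp only [mem_setOf_eq] at hθ hθ'
  unfold poissonLogLik
  simp only [smul_eq_mul, Finset.mul_sum, ← Finset.sum_add_distrib, map_add, map_smul,
    Pi.add_apply, Pi.smul_apply]
  refine Finset.sum_le_sum fun i _ => ?_
  have hlog : a • Real.log (M θ i) + b • Real.log (M θ' i) ≤ Real.log (a • M θ i + b • M θ' i) :=
    strictConcaveOn_log_Ioi.concaveOn.2 (hθ i) (hθ' i) ha hb hab
  simp only [smul_eq_mul] at hlog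
  have hy : (0 : ℝ) ≤ y i := Nat.cast_nonneg _
  obtain rfl : b = 1 - a := by linarith
  nlinarith [mul_le_mul_of_nonneg_left hlog hy]

/-- The ML estimate maximises `∑ (yᵢ log μᵢ − μᵢ)` (the constant `−∑ log yᵢ!` is dropped).
[cite: BoydVandenberghe2004, §7.1.1] -/
theorem isMaxOn_poissonLogLik_iff (M : Θ →ₗ[ℝ] (ι → ℝ)) (y : ι → ℕ) (s : Set Θ) (θ : Θ) :
    IsMaxOn (poissonLogLik M y) s θ ↔
      IsMaxOn (fun θ => ∑ i, ((y i : ℝ) * Real.log (M θ i) - M θ i)) s θ := by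
  simp only [isMaxOn_iff, poissonLogLik, Finset.sum_sub_distrib, sub_le_sub_iff_right]

end Poisson

/-! ## Logistic regression -/

section Logistic

variable {Θ : Type*} [AddCommGroup Θ] [Module ℝ Θ]

/-- The logistic model (7.3): `prob(y = 1) = e^{z}/(1 + e^{z})` is Mathlib's `Real.sigmoid z`.
[cite: BoydVandenberghe2004, §7.1.1 (7.3)] -/
theorem sigmoid_eq_exp_div (z : ℝ) : Real.sigmoid z = Real.exp z / (1 + Real.exp z) := by
  rw [Real.sigmoid_def, Real.exp_neg]
  field_simp
  ring

/-- The logistic log-likelihood `l(θ) = ∑_{yᵢ=1} log pᵢ + ∑_{yᵢ=0} log(1 − pᵢ)`,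
`pᵢ = σ(zᵢ(θ))`, scores `zᵢ(θ) = (M θ) i` linear in `θ = (a, b)` (`zᵢ = aᵀuᵢ + b`).
[cite: BoydVandenberghe2004, §7.1.1 (7.3)] -/
def logisticLogLik (M : Θ →ₗ[ℝ] (ι → ℝ)) (y : ι → Bool) (θ : Θ) : ℝ :=
  ∑ i, if y i then Real.log (Real.sigmoid (M θ i)) else Real.log (1 - Real.sigmoid (M θ i))

/-- `log σ(z) = z − log(1 + eᶻ)`. [cite: BoydVandenberghe2004, §7.1.1] -/
theorem log_sigmoid (z : ℝ) : Real.log (Real.sigmoid z) = z - Real.log (1 + Real.exp z) := by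
  rw [sigmoid_eq_exp_div, Real.log_div (Real.exp_pos z).ne' (by positivity), Real.log_exp]

/-- `log (1 − σ(z)) = −log(1 + eᶻ)`. [cite: BoydVandenberghe2004, §7.1.1] -/
theorem log_one_sub_sigmoid (z : ℝ) :
    Real.log (1 - Real.sigmoid z) = -Real.log (1 + Real.exp z) := by
  rw [← Real.sigmoid_neg, Real.sigmoid_def, neg_neg, Real.log_inv]

/-- **`l(θ) = ∑_{yᵢ=1} zᵢ − ∑ᵢ log(1 + e^{zᵢ})`**. [cite: BoydVandenberghe2004, §7.1.1] -/
theorem logisticLogLik_eq (M : Θ →ₗ[ℝ] (ι → ℝ)) (y : ι → Bool) (θ : Θ) :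
    logisticLogLik M y θ =
      ∑ i, (if y i then M θ i else 0) - ∑ i, Real.log (1 + Real.exp (M θ i)) := by
  unfold logisticLogLik
  rw [← Finset.sum_sub_distrib]
  refine Finset.sum_congr rfl fun i _ => ?_
  split_ifs
  · rw [log_sigmoid]
  · rw [log_one_sub_sigmoid]; ring

/-- The softplus function `t ↦ log(1 + eᵗ)` has derivative `σ(t)`.
[cite: BoydVandenberghe2004, §7.1.1] -/
theorem hasDerivAt_softplus (t : ℝ) :
    HasDerivAt (fun t => Real.log (1 + Real.exp t)) (Real.sigmoid t) t := by
  have h := ((Real.hasDerivAt_exp t).const_add 1).log (by positivity)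
  convert h using 1
  rw [sigmoid_eq_exp_div]

/-- The softplus function is convex (its derivative `σ` is monotone).
[cite: BoydVandenberghe2004, §7.1.1] -/
theorem convexOn_softplus : ConvexOn ℝ univ (fun t => Real.log (1 + Real.exp t)) := by
  have hd : deriv (fun t => Real.log (1 + Real.exp t)) = Real.sigmoid :=
    funext fun t => (hasDerivAt_softplus t).deriv
  refine Monotone.convexOn_univ_of_deriv (fun t => (hasDerivAt_softplus t).differentiableAt) ?_
  rw [hd]; exact Real.sigmoid_monotone

/-- **Logistic regression is a convex problem**: `l` is concave in `θ`.
[cite: BoydVandenberghe2004, §7.1.1] -/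
theorem concaveOn_logisticLogLik (M : Θ →ₗ[ℝ] (ι → ℝ)) (y : ι → Bool) :
    ConcaveOn ℝ univ (logisticLogLik M y) := by
  have h1 : ConcaveOn ℝ univ (fun θ : Θ => ∑ i, (if y i then M θ i else 0)) := by
    refine concaveOn_univ_sum _ fun i _ => ?_
    by_cases hy : y i
    · simp only [hy, if_true]
      exact ((LinearMap.proj i).comp M).concaveOn convex_univ
    · simp only [hy]; exact concaveOn_const 0 convex_univ
  have h2 : ConvexOn ℝ univ (fun θ : Θ => ∑ i, Real.log (1 + Real.exp (M θ i))) := by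
    refine convexOn_univ_sum _ fun i _ => ?_
    refine (convexOn_comp_sub_linear convexOn_softplus (-((LinearMap.proj i).comp M)) 0).congr ?_
    intro θ _
    simp
  have : logisticLogLik M y = fun θ => (∑ i, (if y i then M θ i else 0)) +
      -(∑ i, Real.log (1 + Real.exp (M θ i))) := by
    funext θ; rw [logisticLogLik_eq, sub_eq_add_neg]
  rw [this]
  exact h1.add h2.neg

end Logistic

end

end Literature.Analysis.Convex.MaximumLikelihoodEstimation
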